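import Literature.Geometry.Lorentzian.KlainermanSzeftel2021.NearZoneCount

/-!
# Klainerman–Szeftel Lemma 9.4.13: the outgoing transport of `r⁴B` at Theorem M1's rate, the `r^{3+δ_B}`-count it closes (iff `δ_B < 2δ_extra`), and the inward transport that does not

CITATION HEADER (lean-in-tree rule 2026-08-18).  Arithmetic of exponents and two one-variable integrations read off

* S. Klainerman, J. Szeftel, *Kerr stability for small angular momentum*, arXiv:2104.11857 (v1, 2021; TeX source
  `Main-Kerr-arxiv.tex`, `KS l.N`) = bib key `KlainermanSzeftel2021` (journal: Pure Appl. Math. Q. **19** (2023) no. 3 —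
  the journal text of §9.4 was not separately read here; acquisition request `acq-07685` of the audit cell is open);
* E. Giorgi, S. Klainerman, J. Szeftel, *Wave equations estimates and the nonlinear stability of slowly rotating Kerr black
  holes*, arXiv:2205.14808 (TeX source `FinalKerrarxivversion.tex`, `GKS l.N`) = bib key `GiorgiKlainermanSzeftel2022`
  (refereed: Pure Appl. Math. Q. **20** (2024) no. 7, 2865–3849 = bib key `GiorgiKlainermanSzeftel2024`, read in the authors'
  version HAL hal-05348127 — `HAL p. N` is a page of that text, not a journal page; REFEREE #19 L-6), only for the printed VALUE
  `δ_extra = (3δ_dec − 2δ)/2 > δ_dec` (GKS l.22524, HAL p. 532) and the printed range "`2δ ≤ δ_dec`" (GKS l.24524), through the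
  companion modules.

WHAT IS COUNTED.  The companion modules `…KlainermanSzeftel2021.SupToFluxExponents` (powers of `r`), `…NearZoneCount`
(powers of `u` in the near zones) and `…MixedRateCount` (mixing with the size-`ε` bootstrap rate) record that the one-sentence
step of the proof of Lemma 9.4.13 — KS l.24420–24425, "The weights in `r`, `u` and `u̲` are enough to take care of the spacetime
integrations in the global norms …" ⇒ (9.4.22) `𝔖_{k_small−1} + ℜ_{k_small−1} ≲ ε₀` — does not verify, for the `r^{3+δ_B}`-weighted
`B`-terms of `ᵉˣᵗℜ_k² ∋ ∫_{ᵉˣᵗ𝓜} r^{3+δ_B}|𝔡^{≤k}B|²` (KS l.23912–23915; the audit's reading of the 4-volume: `≍ r² dr du dσ`), from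
any `ε₀`-SIZE pointwise bound for `B` located in KS/GKS, and name what would: an `ε₀`-size pointwise `r`-rate `> 3 + δ_B/2` with
`u^{-½-δ_X}`, `δ_B < 2δ_X`, for `𝔡^{≤k_small−1}B` on the exterior region of the extended spacetime (registry leaf KS9.4.13-Brate of
the audit, NOT located in KS/GKS).  The audit cell's lead (GAPS.md block 9, items (5)–(6)) proposed WHERE such a bound would come
from and where it would not:

* (6) OUTGOING.  KS's linearised Bianchi identity `∇₄B + (4/q̄)B = ½𝒟̄·A + (aq/2|q|²)𝔍̄·A + Γ_g·(B,A)`, rewritten by KS as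
  `∇₄B = −(4/r)B + O(r^{-2})B + O(r^{-1})𝔡^{≤1}A + r^{-1}Γ_g·Γ_g` (KS l.16086–16093), transports `r⁴B` along the OUTGOING null
  lines `u = const` with source `r⁴ · O(r^{-1})𝔡^{≤1}A`; Theorem M1 item 2 (KS l.6684–6687, `k ≤ k_small+100`) bounds
  `sup_{ᵉˣᵗ𝓜} ( r²(2r+u)^{1+δ_extra}/log(1+u) + r³(2r+u)^{½+δ_extra} ) (|𝔡^k A| + r|𝔡^{k−1}∇₃A|) ≲ ε₀` — TWO weights on the same
  quantity; this module uses only the SECOND weight, `r³(2r+u)^{½+δ_extra}(|𝔡^k A| + r|𝔡^{k−1}∇₃A|) ≲ ε₀` (a valid weakening of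
  item 2: the sum dominates each summand; the first, log-weighted weight is not used; REFEREE #20 N-8), which makes that source `≲ ε₀ (2r+u)^{-½-δ_extra}`.  Integrating OUTWARD from
  `r = r₀` (data there from Theorem M7's decay norm, `ru^{1+δ_dec}|𝔡^{≤k}Γ_g| ≲ ε₀`, `rB ∈ Γ_g`, KS l.5826–5831:
  `|𝔡^{≤k}B|(u,r₀) ≲ ε₀ r₀^{-2} u^{-1-δ_dec}`) would give
  `|B| ≲ ε₀ (r₀² r^{-4} u^{-1-δ_dec} + r^{-3} u^{-½-δ_extra})` for `r ≤ u` and `≲ ε₀ r^{-7/2-δ_extra}` for `r ≥ u` — EXACTLY Theorem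
  M1's `A`-profile plus an `r^{-4}` initial layer term (§§1–2 below: the two one-variable integrations, with constants).
* (5) INWARD.  The `ε₀`-size inputs with a better `r`-rate that KS does print — Theorem M0 on `𝓑₁` (rate `7/2+δ_B`, l.6653–6657),
  the `Σ_*`-bound (rate `7/2+δ_extra`, l.12791), and the `∇₃B` component of Theorem M7's decay norm,
  `r⁴u^{½+δ_dec}|𝔡^{≤k−1}∇₃B| ≲ ε₀` (l.5828) — propagate along `e₃` (incoming); integrating `|∇₃B| ≲ ε₀ r^{-4}u^{-½-δ_dec}` inward
  reproduces `ε₀ r^{-3} u^{-½-δ_dec}` (§4): the same near profile, with the PRINTED `u`-rate `δ_X = δ_dec`, whose zone-II count is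
  not uniform in the bootstrap time (`NearZoneCount.zoneII_printed_unbounded`).

THE COUNT (§3, this module; KS allows the implicit constants to depend on `r₀`, l.6118–6121).  With the transported profile of (6)
the `B`-part of `ᵉˣᵗℜ²` splits into an initial-layer term (rate `4`, margin `2 − δ_B` = companion `marginB_rate4`; `u^{-2-2δ_dec}`),
a NEAR term (`r₀ ≤ r ≤ u`: `r`-integrand `r^{-1+δ_B}`, `∫_{r₀}^{u} ≤ u^{δ_B}/δ_B`, times `u^{-1-2δ_extra}`: exponent `uExpII δ_B δ_extra`
of `NearZoneCount`) and a FAR term (`r ≥ max(r₀,u)`: margin `1 + 2δ_extra − δ_B` = companion `marginB_rateM1`, `∫_{u}^{R} ≤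
u^{-(1+2δ_extra−δ_B)}/(1+2δ_extra−δ_B)`, NO `u`-weight).  All three are bounded UNIFORMLY in the bootstrap time `U = u_*` and in
the outer radius `R ≍ r_*` iff `δ_B < 2δ_extra` — the near term by `∫_1^U u^{-1-(2δ_extra−δ_B)} ≤ 1/(2δ_extra−δ_B)` and,
INDEPENDENTLY, the far term by the same `u`-integral (this is the kernel form of the `θ`-splitting remark for the `(2r+u)`-profile in
the header of `SupToFluxExponents`: no `θ` is needed, the far zone simply starts at `r = u`); for `δ_B > 2δ_extra` both diverge
(`near_unbounded_outside`, `far_unbounded_outside`).  The iterated integrals are evaluated in CLOSED FORM (`nearInner_eq`,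
`farInner_eq`), so the `u`-integration is an honest interval integral of a continuous function (`near_iterated_bounded`,
`far_iterated_bounded`), not only a per-`u` bound times a `u`-integral.  Together with KS (3.4.4) `δ_B > 2δ_dec` (l.6076–6081) the
condition is the WINDOW `2δ_dec < δ_B < 2δ_extra` of `NearZoneCount` (§5: at GKS's value `2δ_extra = 3δ_dec − 2δ` the window is
nonempty iff `δ < δ_dec/2`, which GKS PRINTS — l.22524 "`δ_extra = (3δ_dec − 2δ)/2 > δ_dec`", companion `deltaExtraGKS_gt_iff`;
what print does not decide is the MEMBERSHIP `δ_B < 2δ_extra`: KS prints only `δ_B > 2δ_dec`, and parameter points admissible under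
every printed constraint exist on both sides, `window_undecided_by_print`; REFEREE #19 N-6).

STATUS.  Census arithmetic of the audit cell `pub-kerr` (GAPS.md K20b‴ items (5)–(6): the lead's REPAIR ROUTE R1 for the precise
gap E-9413 / KS9.4.13-Brate; class E, priced, NOT an error claim — under the bootstrap assumption (9.4.20), KS l.24317–24319,
`ℜ_{k_small−1} ≤ ε` holds outright; at issue is only the `ε₀`-size improvement asserted by (9.4.22)).  The transport inequality
`TransportIneq` and the inward inequality `InwardIneq` are HYPOTHESIS SHAPES over real functions of one variable (what an
integration of KS l.16086–16093, resp. of the `∇₃B` bound, along a null line would deliver); whether they hold on the exterior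
region of the M7-extended spacetime at level `k ≤ k_small − 1` (one more derivative on `A` than on `B`) is exactly the unprinted
piece (u1)–(u2) of GAPS block 9 (6) and is NOT asserted here.  KS obtains `B` on `ᵉˣᵗ𝓜` through `𝒟⊗̂B + (Z+4H)⊗̂B = ∇₃A + …` (Step 2 of the proof of
Proposition `Proposition:estimatesforBPcXhZc-halfdecayinu` l.16632–16640, KS l.16656–16668, display l.16659; Step 1, l.16645–16654, is the `∇₄X̂` transport — locator corrected after
REFEREE #20 L-7), which yields the rate `3 + δ'` only (companion `rateB_improved`).  KS and GKS are refereed publications under adjudication in the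
audit cell: their displays enter as parameters and hypothesis shapes, never as cited facts; nothing here is Final-State-Conjecture
progress.
-/

open Real Set MeasureTheory intervalIntegral Filter

noncomputable section

namespace Literature.Geometry.Lorentzian.KlainermanSzeftel2021.OutgoingTransportCount

open Literature.Geometry.Lorentzian.KlainermanSzeftel2021.SupToFluxExponents
open Literature.Geometry.Lorentzian.KlainermanSzeftel2021.NearZoneCount

/-! ## §1 The source integral of the outgoing transport of `r⁴B` -/

/-- The transport source at Theorem M1's rate: `(2s + u)^{-(½+δ_extra)}` (from `r⁴ · O(r^{-1})𝔡^{≤1}A` with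
`r³(2r+u)^{½+δ_extra}|𝔡^{≤k}A| ≲ ε₀`, the second of the two weights of Theorem M1 item 2 — a consequence of item 2, REFEREE #20 N-8).
[cite: KlainermanSzeftel2021, Theorem M1 item 2 (second weight) TeX l.6684–6687; transport of B l.16086–16093] -/
def srcKernel (u δe : ℝ) (s : ℝ) : ℝ := (2 * s + u) ^ (-(1 / 2 + δe))

/-- [folklore] -/
theorem srcKernel_nonneg {u s : ℝ} (δe : ℝ) (hu : 0 < u) (hs : 0 ≤ s) : 0 ≤ srcKernel u δe s := by
  unfold srcKernel; exact rpow_nonneg (by linarith) _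

/-- NEAR pointwise bound: `(2s+u)^{-(½+δe)} ≤ u^{-(½+δe)}` for `s ≥ 0` (the exponent is nonpositive).  [folklore] -/
theorem srcKernel_le_near {u s δe : ℝ} (hu : 0 < u) (hs : 0 ≤ s) (hδ : 0 ≤ 1 / 2 + δe) :
    srcKernel u δe s ≤ u ^ (-(1 / 2 + δe)) := by
  unfold srcKernel
  exact rpow_le_rpow_of_nonpos hu (by linarith) (by linarith)

/-- The source is continuous on `[r₀, r]` (`r₀ ≥ 0`, `u > 0`), hence interval-integrable.  [folklore] -/
theorem intervalIntegrable_srcKernel {u r₀ r : ℝ} (δe : ℝ) (hu : 0 < u) (hr₀ : 0 ≤ r₀) (hr : r₀ ≤ r) :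
    IntervalIntegrable (srcKernel u δe) volume r₀ r := by
  refine ContinuousOn.intervalIntegrable ?_
  rw [uIcc_of_le hr]
  unfold srcKernel
  refine ContinuousOn.rpow_const ?_ ?_
  · exact (continuousOn_const.mul continuousOn_id).add continuousOn_const
  · intro x hx; left; have : 0 ≤ x := hr₀.trans hx.1; linarith

/-- NEAR BOUND of the source integral: `∫_{r₀}^{r} (2s+u)^{-(½+δe)} ds ≤ (r − r₀)·u^{-(½+δe)}` — on `r ≤ u` this is what makes
`B` inherit the near profile `r^{-3}u^{-½-δ_extra}`.  [folklore] -/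
theorem source_integral_le_near {u δe r₀ r : ℝ} (hu : 0 < u) (hr₀ : 0 ≤ r₀) (hr : r₀ ≤ r) (hδ : 0 ≤ 1 / 2 + δe) :
    ∫ s in r₀..r, srcKernel u δe s ≤ (r - r₀) * u ^ (-(1 / 2 + δe)) := by
  have h : ∀ s ∈ Set.uIoc r₀ r, ‖srcKernel u δe s‖ ≤ u ^ (-(1 / 2 + δe)) := by
    intro s hs
    rw [uIoc_of_le hr] at hs
    have hs0 : 0 ≤ s := hr₀.trans hs.1.le
    rw [Real.norm_of_nonneg (srcKernel_nonneg δe hu hs0)]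
    exact srcKernel_le_near hu hs0 hδ
  have key := norm_integral_le_of_norm_le_const h
  rw [abs_of_nonneg (by linarith : 0 ≤ r - r₀)] at key
  calc ∫ s in r₀..r, srcKernel u δe s ≤ ‖∫ s in r₀..r, srcKernel u δe s‖ := Real.le_norm_self _
    _ ≤ u ^ (-(1 / 2 + δe)) * (r - r₀) := key
    _ = (r - r₀) * u ^ (-(1 / 2 + δe)) := mul_comm _ _

/-- The antiderivative of the source: `(2s+u)^{½−δe}/(2(½−δe))`.  [folklore] -/
def srcPrimitive (u δe : ℝ) (s : ℝ) : ℝ := (2 * s + u) ^ (1 / 2 - δe) / (2 * (1 / 2 - δe))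

/-- [folklore] -/
theorem hasDerivAt_srcPrimitive {u δe s : ℝ} (hδ : δe < 1 / 2) (hs : 0 < 2 * s + u) :
    HasDerivAt (srcPrimitive u δe) (srcKernel u δe s) s := by
  have hlin : HasDerivAt (fun x : ℝ => 2 * x + u) 2 s := by
    simpa using ((hasDerivAt_id s).const_mul (2:ℝ)).add_const u
  have hpow := hlin.rpow_const (p := 1 / 2 - δe) (Or.inl hs.ne')
  have hdiv := hpow.div_const (2 * (1 / 2 - δe))
  have hq : (2 : ℝ) * (1 / 2 - δe) ≠ 0 := by
    have : (0:ℝ) < 1 / 2 - δe := by linarith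
    positivity
  have heq : 2 * (1 / 2 - δe) * (2 * s + u) ^ (1 / 2 - δe - 1) / (2 * (1 / 2 - δe)) = srcKernel u δe s := by
    rw [mul_div_cancel_left₀ _ hq]; unfold srcKernel; congr 1; ring
  unfold srcPrimitive
  rw [← heq]
  convert hdiv using 1

/-- CLOSED FORM of the source integral (fundamental theorem of calculus).  [folklore] -/
theorem source_integral_eq {u δe r₀ r : ℝ} (hu : 0 < u) (hr₀ : 0 ≤ r₀) (hr : r₀ ≤ r) (hδ : δe < 1 / 2) :
    ∫ s in r₀..r, srcKernel u δe s = srcPrimitive u δe r - srcPrimitive u δe r₀ := by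
  apply integral_eq_sub_of_hasDerivAt
  · intro x hx
    rw [uIcc_of_le hr] at hx
    exact hasDerivAt_srcPrimitive hδ (by have := hx.1; linarith)
  · exact intervalIntegrable_srcKernel δe hu hr₀ hr

/-- FAR BOUND of the source integral: `∫_{r₀}^{r} (2s+u)^{-(½+δe)} ds ≤ (2r+u)^{½−δe}/(1−2δe)`.  [folklore] -/
theorem source_integral_le_far {u δe r₀ r : ℝ} (hu : 0 < u) (hr₀ : 0 ≤ r₀) (hr : r₀ ≤ r) (hδ : δe < 1 / 2) :
    ∫ s in r₀..r, srcKernel u δe s ≤ (2 * r + u) ^ (1 / 2 - δe) / (1 - 2 * δe) := by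
  rw [source_integral_eq hu hr₀ hr hδ]
  unfold srcPrimitive
  have hq : 0 < 1 - 2 * δe := by linarith
  have h2q : 2 * (1 / 2 - δe) = 1 - 2 * δe := by ring
  rw [h2q]
  have hpos : 0 ≤ (2 * r₀ + u) ^ (1 / 2 - δe) / (1 - 2 * δe) :=
    div_nonneg (rpow_nonneg (by linarith) _) hq.le
  linarith

/-- On the far zone `r ≥ u` one has `2r + u ≤ 3r`, so `(2r+u)^{½−δe} ≤ 3·r^{½−δe}` (for `0 ≤ δe < ½`; we use `3^{½−δe} ≤ 3`).
[folklore] -/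
theorem far_base_le {u δe r : ℝ} (hu : 0 < u) (hur : u ≤ r) (hδ0 : 0 ≤ δe) (hδ : δe < 1 / 2) :
    (2 * r + u) ^ (1 / 2 - δe) ≤ 3 * r ^ (1 / 2 - δe) := by
  have hr : 0 < r := hu.trans_le hur
  have hq0 : 0 ≤ 1 / 2 - δe := by linarith
  have h1 : (2 * r + u) ^ (1 / 2 - δe) ≤ (3 * r) ^ (1 / 2 - δe) :=
    rpow_le_rpow (by linarith) (by linarith) hq0
  have h2 : (3 * r) ^ (1 / 2 - δe) = 3 ^ (1 / 2 - δe) * r ^ (1 / 2 - δe) := mul_rpow (by norm_num) hr.le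
  have h3 : (3:ℝ) ^ (1 / 2 - δe) ≤ 3 := by
    calc (3:ℝ) ^ (1 / 2 - δe) ≤ 3 ^ (1:ℝ) := rpow_le_rpow_of_exponent_le (by norm_num) (by linarith)
      _ = 3 := rpow_one 3
  rw [h2] at h1
  exact h1.trans (mul_le_mul_of_nonneg_right h3 (rpow_nonneg hr.le _))

/-- FAR BOUND on `r ≥ u`: `∫_{r₀}^{r} (2s+u)^{-(½+δe)} ds ≤ (3/(1−2δe))·r^{½−δe}` — this is what makes `B` inherit the far rate
`7/2 + δ_extra` of Theorem M1's `A`.  [folklore] -/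
theorem source_integral_le_far' {u δe r₀ r : ℝ} (hu : 0 < u) (hr₀ : 0 ≤ r₀) (hr : r₀ ≤ r) (hur : u ≤ r)
    (hδ0 : 0 ≤ δe) (hδ : δe < 1 / 2) :
    ∫ s in r₀..r, srcKernel u δe s ≤ 3 / (1 - 2 * δe) * r ^ (1 / 2 - δe) := by
  have hq : 0 < 1 - 2 * δe := by linarith
  calc ∫ s in r₀..r, srcKernel u δe s ≤ (2 * r + u) ^ (1 / 2 - δe) / (1 - 2 * δe) :=
        source_integral_le_far hu hr₀ hr hδ
    _ ≤ 3 * r ^ (1 / 2 - δe) / (1 - 2 * δe) :=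
        div_le_div_of_nonneg_right (far_base_le hu hur hδ0 hδ) hq.le
    _ = 3 / (1 - 2 * δe) * r ^ (1 / 2 - δe) := by ring

/-! ## §2 The transported profile: `B` inherits Theorem M1's `A`-profile plus an `r^{-4}` initial term -/

/-- HYPOTHESIS SHAPE (not asserted for KS's spacetime): the integrated outgoing transport inequality along a null line
`u = const` of the exterior region, for `F(r) = r⁴|𝔡^{≤k}B|(u,r)` and source amplitude `e ≍ ε₀`:
`F(r) ≤ F(r₀) + e ∫_{r₀}^{r} (2s+u)^{-(½+δ_extra)} ds` — what integrating KS's `∇₄B = −(4/r)B + O(r^{-2})B + O(r^{-1})𝔡^{≤1}A + …`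
with Theorem M1's bound on `A` would give (the `O(r^{-2})B` Grönwall factor and the quadratic terms absorbed into the constants).
[cite: KlainermanSzeftel2021, transport of B TeX l.16086–16093; Theorem M1 item 2 l.6684–6687] -/
def TransportIneq (F : ℝ → ℝ) (e u δe r₀ : ℝ) : Prop :=
  ∀ r, r₀ ≤ r → F r ≤ F r₀ + e * ∫ s in r₀..r, srcKernel u δe s

/-- [folklore] -/
private theorem rpow_m4_mul_self {r : ℝ} (hr : 0 < r) : r * r ^ (-4:ℝ) = r ^ (-3:ℝ) := by
  rw [show (-3:ℝ) = 1 + (-4) by norm_num, rpow_add hr, rpow_one]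

/-- [folklore] -/
private theorem rpow_m4_mul_half {r δe : ℝ} (hr : 0 < r) :
    r ^ (1 / 2 - δe) * r ^ (-4:ℝ) = r ^ (-(7 / 2 + δe)) := by
  rw [← rpow_add hr]; congr 1; ring

/-- NEAR PROFILE (all `r ≥ r₀`): `|𝔡^{≤k}B| = F(r)·r^{-4} ≤ F(r₀)·r^{-4} + e·r^{-3}·u^{-(½+δ_extra)}` — rate `3` in `r` (the RECORDED
rate of the companion file) but with the `u`-rate `δ_X = δ_extra` of Theorem M1 in place of Theorem M7's `δ_dec`.
[cite: KlainermanSzeftel2021, Theorem M1 item 2 TeX l.6684–6687 (the profile inherited); transport of B l.16086–16093] -/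
theorem profile_near {F : ℝ → ℝ} {e u δe r₀ : ℝ} (hT : TransportIneq F e u δe r₀) (he : 0 ≤ e) (hu : 0 < u)
    (hr₀ : 0 < r₀) (hδ : 0 ≤ 1 / 2 + δe) {r : ℝ} (hr : r₀ ≤ r) :
    F r * r ^ (-4:ℝ) ≤ F r₀ * r ^ (-4:ℝ) + e * (r ^ (-3:ℝ) * u ^ (-(1 / 2 + δe))) := by
  have hr0 : 0 < r := hr₀.trans_le hr
  have hr4 : 0 < r ^ (-4:ℝ) := rpow_pos_of_pos hr0 _
  have h1 : F r ≤ F r₀ + e * (r * u ^ (-(1 / 2 + δe))) := by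
    have hint := source_integral_le_near hu hr₀.le hr hδ
    have hup : 0 ≤ u ^ (-(1 / 2 + δe)) := rpow_nonneg hu.le _
    have : (r - r₀) * u ^ (-(1 / 2 + δe)) ≤ r * u ^ (-(1 / 2 + δe)) :=
      mul_le_mul_of_nonneg_right (by linarith) hup
    have := mul_le_mul_of_nonneg_left (hint.trans this) he
    linarith [hT r hr]
  have h2 := mul_le_mul_of_nonneg_right h1 hr4.le
  calc F r * r ^ (-4:ℝ) ≤ (F r₀ + e * (r * u ^ (-(1 / 2 + δe)))) * r ^ (-4:ℝ) := h2
    _ = F r₀ * r ^ (-4:ℝ) + e * ((r * r ^ (-4:ℝ)) * u ^ (-(1 / 2 + δe))) := by ring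
    _ = F r₀ * r ^ (-4:ℝ) + e * (r ^ (-3:ℝ) * u ^ (-(1 / 2 + δe))) := by rw [rpow_m4_mul_self hr0]

/-- FAR PROFILE (`r ≥ u`): `F(r)·r^{-4} ≤ F(r₀)·r^{-4} + e·(3/(1−2δ_extra))·r^{-(7/2+δ_extra)}` — the far rate `7/2 + δ_extra` of
Theorem M1's `A` (companion `rateA_M1`), with NO `u`-decay.
[cite: KlainermanSzeftel2021, Theorem M1 item 2 TeX l.6684–6687 (the profile inherited); transport of B l.16086–16093] -/
theorem profile_far {F : ℝ → ℝ} {e u δe r₀ : ℝ} (hT : TransportIneq F e u δe r₀) (he : 0 ≤ e) (hu : 0 < u)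
    (hr₀ : 0 < r₀) (hδ0 : 0 ≤ δe) (hδ : δe < 1 / 2) {r : ℝ} (hr : r₀ ≤ r) (hur : u ≤ r) :
    F r * r ^ (-4:ℝ) ≤ F r₀ * r ^ (-4:ℝ) + e * (3 / (1 - 2 * δe)) * r ^ (-(7 / 2 + δe)) := by
  have hr0 : 0 < r := hr₀.trans_le hr
  have hr4 : 0 < r ^ (-4:ℝ) := rpow_pos_of_pos hr0 _
  have h1 : F r ≤ F r₀ + e * (3 / (1 - 2 * δe) * r ^ (1 / 2 - δe)) := by
    have hint := source_integral_le_far' hu hr₀.le hr hur hδ0 hδ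
    have := mul_le_mul_of_nonneg_left hint he
    linarith [hT r hr]
  have h2 := mul_le_mul_of_nonneg_right h1 hr4.le
  calc F r * r ^ (-4:ℝ) ≤ (F r₀ + e * (3 / (1 - 2 * δe) * r ^ (1 / 2 - δe))) * r ^ (-4:ℝ) := h2
    _ = F r₀ * r ^ (-4:ℝ) + e * (3 / (1 - 2 * δe)) * (r ^ (1 / 2 - δe) * r ^ (-4:ℝ)) := by ring
    _ = F r₀ * r ^ (-4:ℝ) + e * (3 / (1 - 2 * δe)) * r ^ (-(7 / 2 + δe)) := by rw [rpow_m4_mul_half hr0]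

/-- The two profiles MATCH at `r = u`: `u^{-3}·u^{-(½+δe)} = u^{-(7/2+δe)}` (as Theorem M1's `(2r+u)`-form does).  [folklore] -/
theorem profiles_match (u δe : ℝ) (hu : 0 < u) : u ^ (-3:ℝ) * u ^ (-(1 / 2 + δe)) = u ^ (-(7 / 2 + δe)) := by
  rw [← rpow_add hu]; congr 1; ring

/-- INITIAL VALUE from Theorem M7's decay norm at `r = r₀` (`ru^{1+δ_dec}|𝔡^{≤k}Γ_g| ≲ ε₀`, `rB ∈ Γ_g`): a bound
`|𝔡^{≤k}B|(u,r₀) ≤ ε₀ r₀^{-2} u^{-1-δ_dec}` makes `F(r₀) = r₀⁴|𝔡^{≤k}B|(u,r₀) ≤ ε₀ r₀² u^{-1-δ_dec}` — an `r^{-4}` (rate-4) term with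
amplitude growing like `r₀²` (KS's constants may depend on `r₀`, l.6118–6121).  [cite: KlainermanSzeftel2021, decay norm ᵉˣᵗ𝔇_k TeX l.5826–5831; constants l.6118–6121] -/
theorem initial_value {b₀ ε₀ r₀ u δdec : ℝ} (hr₀ : 0 < r₀) (hb : b₀ ≤ ε₀ * r₀ ^ (-2:ℝ) * u ^ (-1 - δdec)) :
    r₀ ^ (4:ℝ) * b₀ ≤ ε₀ * r₀ ^ (2:ℝ) * u ^ (-1 - δdec) := by
  have h4 : 0 < r₀ ^ (4:ℝ) := rpow_pos_of_pos hr₀ _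
  have := mul_le_mul_of_nonneg_left hb h4.le
  have hpow : r₀ ^ (4:ℝ) * r₀ ^ (-2:ℝ) = r₀ ^ (2:ℝ) := by rw [← rpow_add hr₀]; norm_num
  calc r₀ ^ (4:ℝ) * b₀ ≤ r₀ ^ (4:ℝ) * (ε₀ * r₀ ^ (-2:ℝ) * u ^ (-1 - δdec)) := this
    _ = ε₀ * (r₀ ^ (4:ℝ) * r₀ ^ (-2:ℝ)) * u ^ (-1 - δdec) := by ring
    _ = ε₀ * r₀ ^ (2:ℝ) * u ^ (-1 - δdec) := by rw [hpow]

/-- From the pointwise profile to the SQUARED integrand of `ᵉˣᵗℜ²` (near form; `F ≥ 0` as `F = r⁴|𝔡^{≤k}B|`):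
`(F(r)r^{-4})² ≤ 2(F(r₀)r^{-4})² + 2(e·r^{-3}u^{-(½+δ_extra)})²`, so each zone of the `r^{3+δ_B}|B|²` count is bounded by twice the
initial-layer term plus twice the zone term (§3 counts them separately).  [folklore] -/
theorem profile_near_sq {F : ℝ → ℝ} {e u δe r₀ : ℝ} (hT : TransportIneq F e u δe r₀) (he : 0 ≤ e) (hu : 0 < u)
    (hr₀ : 0 < r₀) (hδ : 0 ≤ 1 / 2 + δe) {r : ℝ} (hr : r₀ ≤ r) (hF : 0 ≤ F r) :
    (F r * r ^ (-4:ℝ)) ^ 2 ≤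
      2 * (F r₀ * r ^ (-4:ℝ)) ^ 2 + 2 * (e * (r ^ (-3:ℝ) * u ^ (-(1 / 2 + δe)))) ^ 2 := by
  have h := profile_near hT he hu hr₀ hδ hr
  have hb : 0 ≤ F r * r ^ (-4:ℝ) := mul_nonneg hF (rpow_nonneg (hr₀.trans_le hr).le _)
  have h1 := pow_le_pow_left₀ hb h 2
  have key : ∀ b p q : ℝ, b ^ 2 ≤ (p + q) ^ 2 → b ^ 2 ≤ 2 * p ^ 2 + 2 * q ^ 2 :=
    fun b p q hbpq => by nlinarith [sq_nonneg (p - q)]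
  exact key _ _ _ h1

/-! ## §3 The `r^{3+δ_B}` bulk count with the transported profile: uniform in `u_*` and `r_*` iff `δ_B < 2δ_extra` -/

/-! ### §3.1 The three radial exponents -/

/-- Initial-layer term (rate `4`): radial exponent `wAB + 2 − 8 = −1 − (2 − δ_B)`, margin `2 − δ_B` (companion `marginB_rate4`).
[cite: KlainermanSzeftel2021, ᵉˣᵗℜ_k TeX l.23912–23915] -/
theorem initial_exponent (δB : ℝ) : wAB δB + 2 - 2 * 4 = -1 - (2 - δB) ∧ margin (wAB δB) 4 = 2 - δB := by
  refine ⟨?_, marginB_rate4 δB⟩; unfold wAB; ring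

/-- Near term (rate `3`): radial exponent `−1 + δ_B` (margin `−δ_B`, companion `marginAB_recorded`), `u`-weight `u^{-1-2δe}`.
[cite: KlainermanSzeftel2021, ᵉˣᵗℜ_k TeX l.23912–23915] -/
theorem near_exponent (δB : ℝ) : wAB δB + 2 - 2 * rateABP_recorded = -1 + δB := by
  unfold wAB rateABP_recorded; ring

/-- Far term (rate `7/2 + δe`): radial exponent `−1 − (1 + 2δe − δ_B)`, margin `1 + 2δe − δ_B` (companion `marginB_rateM1`), NO
`u`-weight.  [cite: KlainermanSzeftel2021, ᵉˣᵗℜ_k TeX l.23912–23915; Theorem M1 item 2 l.6684–6687] -/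
theorem far_exponent (δB δe : ℝ) :
    wAB δB + 2 - 2 * rateA_M1 δe = -1 - (1 + 2 * δe - δB) ∧ margin (wAB δB) (rateA_M1 δe) = 1 + 2 * δe - δB := by
  refine ⟨?_, marginB_rateM1 δB δe⟩; unfold wAB rateA_M1; ring

/-! ### §3.2 Initial-layer term: always uniform -/

/-- Radial integral of the initial-layer term: `∫_{r₀}^{R} r^{-1-(2−δ_B)} dr ≤ r₀^{-(2−δ_B)}/(2−δ_B)` uniformly in `R` (`δ_B < 2`).
[folklore] -/
theorem initial_radial_bounded {δB r₀ R : ℝ} (hB : δB < 2) (hr₀ : 0 < r₀) (hR : r₀ ≤ R) :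
    ∫ x in r₀..R, x ^ (wAB δB + 2 - 2 * 4) ≤ r₀ ^ (-(2 - δB)) / (2 - δB) := by
  rw [(initial_exponent δB).1]
  exact radial_bounded_of_margin_pos (by linarith) hr₀ hR

/-- `u`-integral of the initial-layer term: `(u^{-1-δ_dec})² = u^{-2-2δ_dec}` and `∫_1^U u^{-2-2δ_dec} du ≤ 1/(1+2δ_dec)` uniformly
in `U`.  [folklore] -/
theorem initial_u_bounded {δdec U : ℝ} (hdec : 0 ≤ δdec) (hU : 1 ≤ U) :
    ∫ u in (1:ℝ)..U, u ^ (-2 - 2 * δdec) ≤ 1 / (1 + 2 * δdec) := by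
  have h : (-2 - 2 * δdec : ℝ) = -1 - (1 + 2 * δdec) := by ring
  rw [h]
  have := radial_bounded_of_margin_pos (m := 1 + 2 * δdec) (by linarith) one_pos hU
  simpa [one_rpow] using this

/-- [folklore] -/
theorem initial_u_weight_sq {u δdec : ℝ} (hu : 0 < u) : (u ^ (-1 - δdec)) ^ 2 = u ^ (-2 - 2 * δdec) := by
  rw [← rpow_natCast, ← rpow_mul hu.le]; congr 1; push_cast; ring

/-! ### §3.3 Near term `r₀ ≤ r ≤ u`: closed form, and the `u`-integration -/

/-- The near-zone inner value at bootstrap time `u ≥ r₀`: `(∫_{r₀}^{u} r^{-1+δ_B} dr) · u^{-1-2δe}` (radial integral of the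
near-profile term times its `u`-weight).  [cite: KlainermanSzeftel2021, ᵉˣᵗℜ_k TeX l.23912–23915 with Theorem M1's u-rate l.6684–6687] -/
def nearInner (δB δe r₀ u : ℝ) : ℝ := (∫ x in r₀..u, x ^ (-1 + δB)) * u ^ (-1 - 2 * δe)

/-- CLOSED FORM: `nearInner = ((u^{δ_B} − r₀^{δ_B})/δ_B) · u^{-1-2δe}` (`δ_B > 0`; exponent `−1 + δ_B > −1`).  [folklore] -/
theorem nearInner_eq {δB : ℝ} (δe r₀ u : ℝ) (hB : 0 < δB) :
    nearInner δB δe r₀ u = (u ^ δB - r₀ ^ δB) / δB * u ^ (-1 - 2 * δe) := by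
  unfold nearInner
  rw [integral_rpow (Or.inl (by linarith)), show (-1 + δB + 1) = δB by ring]

/-- Per-`u` bound: `nearInner ≤ u^{uExpII δ_B δe}/δ_B` (`uExpII δ_B δe = δ_B − 1 − 2δe` of `NearZoneCount`).  [folklore] -/
theorem nearInner_le {δB δe r₀ u : ℝ} (hB : 0 < δB) (hr₀ : 0 < r₀) (hu : r₀ ≤ u) :
    nearInner δB δe r₀ u ≤ u ^ uExpII δB δe / δB := by
  have hu0 : 0 < u := hr₀.trans_le hu
  rw [nearInner_eq δe r₀ u hB]
  have h1 : (u ^ δB - r₀ ^ δB) / δB ≤ u ^ δB / δB :=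
    div_le_div_of_nonneg_right (by linarith [rpow_nonneg hr₀.le δB]) hB.le
  have h2 := mul_le_mul_of_nonneg_right h1 (rpow_nonneg hu0.le (-1 - 2 * δe))
  calc (u ^ δB - r₀ ^ δB) / δB * u ^ (-1 - 2 * δe) ≤ u ^ δB / δB * u ^ (-1 - 2 * δe) := h2
    _ = u ^ δB * u ^ (-1 - 2 * δe) / δB := by ring
    _ = u ^ uExpII δB δe / δB := by rw [← rpow_add hu0]; unfold uExpII; congr 2; ring

/-- The closed form is continuous on `[r₀, U]` (so the `u`-integration below is an honest interval integral).  [folklore] -/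
theorem continuousOn_nearClosedForm (δB δe r₀ : ℝ) (hr₀ : 0 < r₀) (U : ℝ) :
    ContinuousOn (fun u : ℝ => (u ^ δB - r₀ ^ δB) / δB * u ^ (-1 - 2 * δe)) (Icc r₀ U) := by
  have hpos : ∀ x ∈ Icc r₀ U, (x:ℝ) ≠ 0 := fun x hx => (hr₀.trans_le hx.1).ne'
  refine ContinuousOn.mul ?_ (continuousOn_id.rpow_const fun x hx => Or.inl (hpos x hx))
  refine ContinuousOn.div_const ?_ _
  exact (continuousOn_id.rpow_const fun x hx => Or.inl (hpos x hx)).sub continuousOn_const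

/-- NEAR TERM, ITERATED AND UNIFORM: for `0 < δ_B < 2δe` and `1 ≤ r₀ ≤ U`,
`∫_{r₀}^{U} nearInner(u) du ≤ 1/(δ_B (2δe − δ_B))`, independently of the bootstrap time `U` (bootstrap times `u < r₀` carry no near
zone).  [folklore] -/
theorem near_iterated_bounded {δB δe r₀ U : ℝ} (hB : 0 < δB) (hw : δB < 2 * δe) (hr₀ : 1 ≤ r₀) (hU : r₀ ≤ U) :
    ∫ u in r₀..U, nearInner δB δe r₀ u ≤ 1 / (δB * (2 * δe - δB)) := by
  have hr₀0 : 0 < r₀ := one_pos.trans_le hr₀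
  have hm : 0 < 2 * δe - δB := by linarith
  -- replace the inner integral by its closed form on `[r₀, U]`
  have hcongr : ∫ u in r₀..U, nearInner δB δe r₀ u =
      ∫ u in r₀..U, (u ^ δB - r₀ ^ δB) / δB * u ^ (-1 - 2 * δe) := by
    apply integral_congr
    intro u hu
    rw [uIcc_of_le hU] at hu
    exact nearInner_eq δe r₀ u hB
  rw [hcongr]
  -- bound the closed form by `u^{uExpII}/δB` and integrate
  have hmono : ∫ u in r₀..U, (u ^ δB - r₀ ^ δB) / δB * u ^ (-1 - 2 * δe) ≤
      ∫ u in r₀..U, (1 / δB) * u ^ (-1 - (2 * δe - δB)) := by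
    apply integral_mono_on hU
    · exact (continuousOn_nearClosedForm δB δe r₀ hr₀0 U).intervalIntegrable_of_Icc hU
    · refine ContinuousOn.intervalIntegrable_of_Icc hU ?_
      exact continuousOn_const.mul
        (continuousOn_id.rpow_const fun x hx => Or.inl ((hr₀0.trans_le hx.1).ne'))
    · intro u hu
      have hle := nearInner_le (δe := δe) hB hr₀0 hu.1
      rw [nearInner_eq δe r₀ u hB] at hle
      have hexp : uExpII δB δe = -1 - (2 * δe - δB) := by unfold uExpII; ring
      rw [hexp] at hle
      calc (u ^ δB - r₀ ^ δB) / δB * u ^ (-1 - 2 * δe) ≤ u ^ (-1 - (2 * δe - δB)) / δB := hle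
        _ = 1 / δB * u ^ (-1 - (2 * δe - δB)) := by ring
  refine hmono.trans ?_
  rw [intervalIntegral.integral_const_mul]
  have hrad := radial_bounded_of_margin_pos hm hr₀0 hU
  have hr₀pow : r₀ ^ (-(2 * δe - δB)) ≤ 1 := by
    apply rpow_le_one_of_one_le_of_nonpos hr₀; linarith
  have hstep : r₀ ^ (-(2 * δe - δB)) / (2 * δe - δB) ≤ 1 / (2 * δe - δB) :=
    div_le_div_of_nonneg_right hr₀pow hm.le
  calc 1 / δB * ∫ u in r₀..U, u ^ (-1 - (2 * δe - δB)) ≤ 1 / δB * (1 / (2 * δe - δB)) :=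
        mul_le_mul_of_nonneg_left (hrad.trans hstep) (by positivity)
    _ = 1 / (δB * (2 * δe - δB)) := by rw [one_div_mul_one_div]

/-- NEAR TERM OUTSIDE THE WINDOW (`δ_B > 2δe`): already the per-`u` MAIN part `u^{uExpII}` has `∫_1^U → ∞` (exponent
`−1 + (δ_B − 2δe) > −1`); at `δ_B = 2δe` it is `log U`.  With the PRINTED `u`-rate `δe = δ_dec` this is
`NearZoneCount.zoneII_printed_unbounded`.  [folklore] -/
theorem near_unbounded_outside {δB δe : ℝ} (h : 2 * δe < δB) :
    Tendsto (fun U : ℝ => ∫ u in (1:ℝ)..U, u ^ uExpII δB δe) atTop atTop := by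
  have hexp : uExpII δB δe = -1 + (δB - 2 * δe) := by unfold uExpII; ring
  rw [hexp]
  exact radial_unbounded_of_margin_neg (by linarith) one_pos

/-! ### §3.4 Far term `r ≥ max(r₀, u)`: closed form, and the `u`-integration -/

/-- The far-zone inner value at bootstrap time `u`: `∫_{max(r₀,u)}^{R} r^{-1-(1+2δe−δ_B)} dr` (radial integral of the far-profile
term; it carries NO `u`-weight — the `u`-decay of the far term comes only from where the zone starts).
[cite: KlainermanSzeftel2021, ᵉˣᵗℜ_k TeX l.23912–23915 with Theorem M1's far rate l.6684–6687] -/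
def farInner (δB δe r₀ R u : ℝ) : ℝ := ∫ x in max r₀ u..R, x ^ (-1 - (1 + 2 * δe - δB))

/-- Per-`u` bound: `farInner ≤ u^{-(1+2δe−δ_B)}/(1+2δe−δ_B)` for `0 < u`, `max(r₀,u) ≤ R`, margin `1 + 2δe − δ_B > 0`
(companion `radial_bounded_of_margin_pos` from the radius `max(r₀,u) ≥ u`).  [folklore] -/
theorem farInner_le {δB δe r₀ R u : ℝ} (hm : 0 < 1 + 2 * δe - δB) (hu : 0 < u) (hR : max r₀ u ≤ R) :
    farInner δB δe r₀ R u ≤ u ^ (-(1 + 2 * δe - δB)) / (1 + 2 * δe - δB) := by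
  have hmax : 0 < max r₀ u := lt_max_of_lt_right hu
  have h1 : farInner δB δe r₀ R u ≤ (max r₀ u) ^ (-(1 + 2 * δe - δB)) / (1 + 2 * δe - δB) :=
    radial_bounded_of_margin_pos hm hmax hR
  have h2 : (max r₀ u) ^ (-(1 + 2 * δe - δB)) ≤ u ^ (-(1 + 2 * δe - δB)) :=
    rpow_le_rpow_of_nonpos hu (le_max_right _ _) (by linarith)
  exact h1.trans (div_le_div_of_nonneg_right h2 hm.le)

/-- CLOSED FORM: `farInner = ((max(r₀,u))^{-m} − R^{-m})/m`, `m = 1 + 2δe − δ_B ≠ 0`, for `0 < u`, `0 < R`.  [folklore] -/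
theorem farInner_eq {δB δe r₀ R u : ℝ} (hm : 1 + 2 * δe - δB ≠ 0) (hu : 0 < u) (hR : 0 < R) :
    farInner δB δe r₀ R u =
      ((max r₀ u) ^ (-(1 + 2 * δe - δB)) - R ^ (-(1 + 2 * δe - δB))) / (1 + 2 * δe - δB) := by
  unfold farInner
  have hmax : 0 < max r₀ u := lt_max_of_lt_right hu
  have h0 : (0:ℝ) ∉ uIcc (max r₀ u) R := by
    intro h
    rcases le_total (max r₀ u) R with hle | hle
    · rw [uIcc_of_le hle] at h; linarith [h.1]
    · rw [uIcc_of_ge hle] at h; linarith [h.1]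
  rw [integral_rpow (Or.inr ⟨by intro h'; apply hm; linarith, h0⟩)]
  have h1 : -1 - (1 + 2 * δe - δB) + 1 = -(1 + 2 * δe - δB) := by ring
  rw [h1, div_eq_div_iff (by intro h'; apply hm; linarith) hm]
  ring

/-- The closed form is continuous in the bootstrap time `u` on `[1, U]`.  [folklore] -/
theorem continuousOn_farClosedForm (δB δe r₀ R : ℝ) (hr₀ : 0 < r₀) (U : ℝ) :
    ContinuousOn (fun u : ℝ => ((max r₀ u) ^ (-(1 + 2 * δe - δB)) - R ^ (-(1 + 2 * δe - δB))) /
      (1 + 2 * δe - δB)) (Icc 1 U) := by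
  refine ContinuousOn.div_const (ContinuousOn.sub ?_ continuousOn_const) _
  have hmaxc : ContinuousOn (fun u : ℝ => max r₀ u) (Icc 1 U) := (continuous_const.max continuous_id).continuousOn
  exact hmaxc.rpow_const fun x _ => Or.inl (lt_max_of_lt_left hr₀).ne'

/-- FAR TERM, ITERATED AND UNIFORM: for `δ_B < 2δe` (hence margin `1 + 2δe − δ_B > 1 > 0`), `0 < r₀ ≤ R`, `1 ≤ U ≤ R`:
`∫_1^U farInner(u) du ≤ 1/((1 + 2δe − δ_B)(2δe − δ_B))`, independently of `U` and `R` — the far zone needs the SAME upper bound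
`δ_B < 2δe` as the near zone (kernel form of the `θ`-splitting remark of the companion header: no `θ` needed).  [folklore] -/
theorem far_iterated_bounded {δB δe r₀ R U : ℝ} (hw : δB < 2 * δe) (hr₀ : 0 < r₀) (hr₀R : r₀ ≤ R)
    (hU : 1 ≤ U) (hUR : U ≤ R) :
    ∫ u in (1:ℝ)..U, farInner δB δe r₀ R u ≤ 1 / ((1 + 2 * δe - δB) * (2 * δe - δB)) := by
  have hm : 0 < 1 + 2 * δe - δB := by linarith
  have hm' : 0 < 2 * δe - δB := by linarith
  have hR : 0 < R := hr₀.trans_le hr₀R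
  have hcongr : ∫ u in (1:ℝ)..U, farInner δB δe r₀ R u =
      ∫ u in (1:ℝ)..U, ((max r₀ u) ^ (-(1 + 2 * δe - δB)) - R ^ (-(1 + 2 * δe - δB))) / (1 + 2 * δe - δB) := by
    apply integral_congr
    intro u hu
    rw [uIcc_of_le hU] at hu
    exact farInner_eq hm.ne' (one_pos.trans_le hu.1) hR
  rw [hcongr]
  have hmono : ∫ u in (1:ℝ)..U, ((max r₀ u) ^ (-(1 + 2 * δe - δB)) - R ^ (-(1 + 2 * δe - δB))) /
      (1 + 2 * δe - δB) ≤ ∫ u in (1:ℝ)..U, (1 / (1 + 2 * δe - δB)) * u ^ (-(1 + 2 * δe - δB)) := by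
    apply integral_mono_on hU
    · exact (continuousOn_farClosedForm δB δe r₀ R hr₀ U).intervalIntegrable_of_Icc hU
    · refine ContinuousOn.intervalIntegrable_of_Icc hU ?_
      exact continuousOn_const.mul
        (continuousOn_id.rpow_const fun x hx => Or.inl ((one_pos.trans_le hx.1).ne'))
    · intro u hu
      have hu0 : 0 < u := one_pos.trans_le hu.1
      have hmax : max r₀ u ≤ R := max_le hr₀R (hu.2.trans hUR)
      have hle := farInner_le (δB := δB) (δe := δe) (r₀ := r₀) hm hu0 hmax
      rw [farInner_eq hm.ne' hu0 hR] at hle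
      calc ((max r₀ u) ^ (-(1 + 2 * δe - δB)) - R ^ (-(1 + 2 * δe - δB))) / (1 + 2 * δe - δB)
          ≤ u ^ (-(1 + 2 * δe - δB)) / (1 + 2 * δe - δB) := hle
        _ = 1 / (1 + 2 * δe - δB) * u ^ (-(1 + 2 * δe - δB)) := by ring
  refine hmono.trans ?_
  rw [intervalIntegral.integral_const_mul]
  have hexp : (-(1 + 2 * δe - δB) : ℝ) = -1 - (2 * δe - δB) := by ring
  rw [hexp]
  have hrad := radial_bounded_of_margin_pos hm' one_pos hU
  rw [one_rpow] at hrad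
  calc 1 / (1 + 2 * δe - δB) * ∫ u in (1:ℝ)..U, u ^ (-1 - (2 * δe - δB))
      ≤ 1 / (1 + 2 * δe - δB) * (1 / (2 * δe - δB)) := mul_le_mul_of_nonneg_left hrad (by positivity)
    _ = 1 / ((1 + 2 * δe - δB) * (2 * δe - δB)) := by rw [one_div_mul_one_div]

/-- FAR TERM OUTSIDE THE WINDOW (`2δe < δ_B < 1 + 2δe`, so the radial margin is still positive): the per-`u` main part
`u^{-(1+2δe−δ_B)}` has exponent `> −1` and `∫_1^U u^{-(1+2δe−δ_B)} du → ∞` — the far zone ALSO fails to be uniform in the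
bootstrap time, independently of the near zone.  [folklore] -/
theorem far_unbounded_outside {δB δe : ℝ} (h : 2 * δe < δB) :
    Tendsto (fun U : ℝ => ∫ u in (1:ℝ)..U, u ^ (-(1 + 2 * δe - δB))) atTop atTop := by
  have hexp : (-(1 + 2 * δe - δB) : ℝ) = -1 + (δB - 2 * δe) := by ring
  rw [hexp]
  exact radial_unbounded_of_margin_neg (by linarith) one_pos

/-! ### §3.5 Summary: the closing condition of the transported count -/

/-- THE TRANSPORTED COUNT CLOSES IFF `δ_B < 2δ_extra` (given `0 < δ_B`, `0 ≤ δ_extra < ½`, `r₀ ≥ 1`): inside, all three terms of the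
`B`-part of `ᵉˣᵗℜ²` — initial layer, near zone, far zone — are bounded by constants depending only on `(δ_B, δ_extra, δ_dec, r₀)`,
uniformly in the bootstrap time `U = u_*` and the outer radius `R ≍ r_*`; this is the exponent bookkeeping of the audit lead's
repair route R1 (registry leaf KS9.4.13-Brate supplied in the form "Theorem M1's profile for `B`").
[cite: KlainermanSzeftel2021, TeX l.24420–24425 (the sentence audited), l.23912–23915, l.6684–6687, l.5826–5831, l.6118–6121] -/
theorem count_uniform_in_window {δB δe δdec r₀ R U : ℝ} (hB : 0 < δB) (hw : δB < 2 * δe) (hδ : δe < 1 / 2)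
    (hdec : 0 ≤ δdec) (hr₀ : 1 ≤ r₀) (hr₀R : r₀ ≤ R) (hU : 1 ≤ U) (hUR : U ≤ R) :
    (∫ x in r₀..R, x ^ (wAB δB + 2 - 2 * 4) ≤ r₀ ^ (-(2 - δB)) / (2 - δB)) ∧
    (∫ u in (1:ℝ)..U, u ^ (-2 - 2 * δdec) ≤ 1 / (1 + 2 * δdec)) ∧
    (r₀ ≤ U → ∫ u in r₀..U, nearInner δB δe r₀ u ≤ 1 / (δB * (2 * δe - δB))) ∧
    (∫ u in (1:ℝ)..U, farInner δB δe r₀ R u ≤ 1 / ((1 + 2 * δe - δB) * (2 * δe - δB))) := by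
  have hr₀0 : 0 < r₀ := one_pos.trans_le hr₀
  refine ⟨initial_radial_bounded (by linarith) hr₀0 hr₀R, initial_u_bounded hdec hU,
    fun h => near_iterated_bounded hB hw hr₀ h, far_iterated_bounded hw hr₀0 hr₀R hU hUR⟩

/-- … AND FAILS TO BE UNIFORM OUTSIDE: for `δ_B > 2δ_extra` both the near and the far `u`-integrals diverge with the bootstrap time.
[cite: KlainermanSzeftel2021, TeX l.24420–24425, l.23912–23915, l.6684–6687] -/
theorem count_not_uniform_outside {δB δe : ℝ} (h : 2 * δe < δB) :
    Tendsto (fun U : ℝ => ∫ u in (1:ℝ)..U, u ^ uExpII δB δe) atTop atTop ∧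
      Tendsto (fun U : ℝ => ∫ u in (1:ℝ)..U, u ^ (-(1 + 2 * δe - δB))) atTop atTop :=
  ⟨near_unbounded_outside h, far_unbounded_outside h⟩

/-! ## §4 The inward transport reproduces the printed near rate (GAPS block 9 item (5)) -/

/-- HYPOTHESIS SHAPE (not asserted for KS's spacetime): the integrated INWARD inequality for `G(r) = |𝔡^{≤k−1}B|(u,r)` from the
`∇₃B` component of Theorem M7's decay norm, `r⁴u^{½+δ_dec}|𝔡^{≤k−1}∇₃B| ≲ ε₀` (along an incoming line, `r` decreasing from the
far boundary `R`): `G(r) ≤ G(R) + e·u^{-(½+δ_dec)} ∫_r^R s^{-4} ds`.  [cite: KlainermanSzeftel2021, decay norm ᵉˣᵗ𝔇_k TeX l.5828] -/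
def InwardIneq (G : ℝ → ℝ) (e u δdec R : ℝ) : Prop :=
  ∀ r, 0 < r → r ≤ R → G r ≤ G R + e * u ^ (-(1 / 2 + δdec)) * ∫ s in r..R, s ^ (-4:ℝ)

/-- `∫_r^R s^{-4} ds ≤ r^{-3}/3` (margin `3`).  [folklore] -/
theorem inward_integral_le {r R : ℝ} (hr : 0 < r) (hR : r ≤ R) : ∫ s in r..R, s ^ (-4:ℝ) ≤ r ^ (-3:ℝ) / 3 := by
  have h := radial_bounded_of_margin_pos (m := 3) (by norm_num) hr hR
  have e : (-1 - 3 : ℝ) = -4 := by norm_num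
  rw [e] at h
  exact h

/-- INWARD PROFILE: `G(r) ≤ G(R) + (e/3)·r^{-3}·u^{-(½+δ_dec)}` — rate `3` with the PRINTED `u`-rate `δ_X = δ_dec`, i.e. exactly the
near branch of Theorem M7's own profile for `B` (`r²u^{½+δ_dec}|𝔡^{≤k}Γ_g| ≲ ε₀`): integrating inward gains nothing for the near
zone.  [cite: KlainermanSzeftel2021, decay norm ᵉˣᵗ𝔇_k TeX l.5826–5831] -/
theorem inward_profile {G : ℝ → ℝ} {e u δdec R : ℝ} (hI : InwardIneq G e u δdec R) (he : 0 ≤ e) (hu : 0 < u)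
    {r : ℝ} (hr : 0 < r) (hrR : r ≤ R) :
    G r ≤ G R + e / 3 * r ^ (-3:ℝ) * u ^ (-(1 / 2 + δdec)) := by
  have h1 := hI r hr hrR
  have hw : 0 ≤ e * u ^ (-(1 / 2 + δdec)) := mul_nonneg he (rpow_nonneg hu.le _)
  have h2 := mul_le_mul_of_nonneg_left (inward_integral_le hr hrR) hw
  calc G r ≤ G R + e * u ^ (-(1 / 2 + δdec)) * ∫ s in r..R, s ^ (-4:ℝ) := h1
    _ ≤ G R + e * u ^ (-(1 / 2 + δdec)) * (r ^ (-3:ℝ) / 3) := by linarith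
    _ = G R + e / 3 * r ^ (-3:ℝ) * u ^ (-(1 / 2 + δdec)) := by ring

/-- … and with `δ_X = δ_dec` the near-zone count is NOT uniform in the bootstrap time under the printed `δ_B > 2δ_dec`
(`NearZoneCount.uExpII_printed_gt`, `NearZoneCount.zoneII_printed_unbounded`): inward information cannot repair zone II.
[cite: KlainermanSzeftel2021, (3.4.4) TeX l.6076–6081; ᵉˣᵗ𝔇_k l.5826–5831] -/
theorem inward_rate_does_not_close {δB δdec : ℝ} (h344 : 2 * δdec < δB) :
    -1 < uExpII δB δdec ∧ Tendsto (fun U : ℝ => ∫ x in (1:ℝ)..U, x ^ uExpII δB δdec) atTop atTop :=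
  ⟨uExpII_printed_gt h344, zoneII_printed_unbounded h344⟩

/-! ## §5 The KS/GKS instance: the window at `δ_extra = (3δ_dec − 2δ)/2` — nonempty by print, membership undecided by print -/

/-- At GKS's printed value `δ_extra = (3δ_dec − 2δ)/2` the transported count closes iff `δ_B < 3δ_dec − 2δ`; with KS (3.4.4)
`δ_B > 2δ_dec` this is the window of `NearZoneCount.window_nonempty_iff` (nonempty iff `δ < δ_dec/2`, i.e. iff GKS's printed
`δ_extra > δ_dec`), and inside it all closing conditions of `NearZoneCount.closing_conditions` hold.
[cite: KlainermanSzeftel2021, (3.4.4) TeX l.6076–6081; GiorgiKlainermanSzeftel2022, TeX l.22524 (refereed GiorgiKlainermanSzeftel2024,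
PAMQ 20 (2024) no. 7; HAL hal-05348127 p.532), l.24524] -/
theorem window_GKS (δB δdec δ : ℝ) :
    (δB < 2 * deltaExtraGKS δdec δ ↔ δB < 3 * δdec - 2 * δ) ∧
      ((∃ δB' : ℝ, 2 * δdec < δB' ∧ δB' < 2 * deltaExtraGKS δdec δ) ↔ δ < δdec / 2) := by
  refine ⟨?_, window_nonempty_iff δdec δ⟩
  rw [two_deltaExtraGKS]

/-- MEMBERSHIP UNDECIDED BY PRINT: KS (3.4.4) prints only `δ_B > 2δ_dec` (and `δ_dec, δ_B ≪ 1`, l.6076–6081); GKS prints `2δ ≤ δ_dec`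
(l.24524) and, through "`δ_extra = (3δ_dec − 2δ)/2 > δ_dec`" (l.22524), the strict `2δ < δ_dec` — so the window itself is nonempty
by print, but parameter points admissible under ALL these printed constraints exist on BOTH sides of `δ_B < 2δ_extra`:
`(δ_B, δ_dec, δ) = (17/800, 1/100, 1/400)` inside (`2δ_dec = 16/800 < 17/800 < 2δ_extra = 20/800`) and `(21/800, 1/100, 1/400)`
outside; only the UPPER bound `δ_B < 2δ_extra` is unprinted (REFEREE #19 N-6).  [cite: KlainermanSzeftel2021, (3.4.4) TeX
l.6076–6081; GiorgiKlainermanSzeftel2022, TeX l.22524, l.24524] -/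
theorem window_undecided_by_print :
    (∃ δB δdec δ : ℝ, 0 < δdec ∧ 0 < δ ∧ 2 * δ < δdec ∧ 2 * δdec < δB ∧ δB < 1 ∧ δB < 2 * deltaExtraGKS δdec δ) ∧
    (∃ δB δdec δ : ℝ, 0 < δdec ∧ 0 < δ ∧ 2 * δ < δdec ∧ 2 * δdec < δB ∧ δB < 1 ∧ 2 * deltaExtraGKS δdec δ < δB) := by
  refine ⟨⟨17/800, 1/100, 1/400, ?_⟩, ⟨21/800, 1/100, 1/400, ?_⟩⟩ <;> unfold deltaExtraGKS <;> norm_num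

/-- For the record, the two repair windows of the audit side by side at GKS's value (`δ_h = δ_dec`): the transported-profile window
of this module / `NearZoneCount` is `δ_B < 2δ_extra = 3δ_dec − 2δ` (reaches `ε₀`), the mixing window of `MixedRateCount` is
`δ_B < δ_dec + δ_extra = (5δ_dec − 2δ)/2` (reaches only `ε₀^{1−κ}`); the mixing window is the SMALLER one whenever `δ_extra > δ_dec`,
i.e. whenever either is compatible with `δ_B > 2δ_dec` at all.  [cite: GiorgiKlainermanSzeftel2022, TeX l.22524; KlainermanSzeftel2021, (3.4.4) l.6076–6081] -/
theorem windows_nested {δdec δ : ℝ} (h : δ < δdec / 2) :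
    δdec + deltaExtraGKS δdec δ < 2 * deltaExtraGKS δdec δ ∧ 2 * δdec < δdec + deltaExtraGKS δdec δ := by
  unfold deltaExtraGKS; constructor <;> linarith

end Literature.Geometry.Lorentzian.KlainermanSzeftel2021.OutgoingTransportCount

end
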